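import Summits.Ventures.PercRepro.ProfileThreeAvgStep
import Summits.Ventures.PercRepro.C025Profile

/-!
# PercRepro — THE WHOLE PROFILE FAMILY (Π) — HENCE `C025` — FROM THE DELETION-MONOTONICITY OF THE CO-RANK-`q`
GAP, UNIFORMLY IN `q` (p10, gen 7; `proofs/P10-AVFULL.md` §7)

For a finite matroid `N`, `q < u`, put `W⁻_{q,u}(N) := #{S : ρ(S) = u, ρ(E ∖ S) ≥ q}` (`levelSetCoQ`),
`D_q(N; u) := Σ_{ρ(B) = q} demand N q u B` and `gap_q(N; u) := C(u,q) · W⁻_{q,u}(N) − D_q(N; u)`.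
`ProfileIneqMinusQ N q u` says `gap_q ≥ 0`; it implies `(Π_{q,u})` since `W⁻ ≤ W`.

**THE UNIFORM CONJECTURE OF RECORD** (`GapMonoQ M z q u`, stated without subtraction): for every finite matroid,
every element `z` and every `q < u`, `gap_q(M ∖ z; u) ≤ gap_q(M; u)`.  DATA (p10 g7, own C `gmq.c`): at EVERY
point of EVERY matroid on `≤ 9` elements (all 383,172 classes on 9 elements; loops and parallel elements included)
for `q = 1 … 5` and every `u > q`: 27,616,104 `(M, q, u, z)` tests, 0 failures; `gap_q ≥ 0` everywhere.
Nothing here asserts it.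

**THEOREMS.**  `profileIneq_of_gapMonoRuleQ`: if every finite matroid on `≥ u + q + 1` elements has one
gap-monotone point at `(q, u)`, then `(Π_{q,u})` holds for every finite matroid — strong induction on `#E`, the base
`#E ≤ u + q` by `B ↦ E ∖ B` (`profileIneqMinusQ_of_card_le`).  `c025Profile_of_gapMonoRuleQ`: the rule at every
`(q, u)` with `q < u` gives night-3's `C025Profile`, and with the tree's bridge `c025_of_profile`,
**`c025_of_gapMonoRuleQ`: the rule gives `C025` itself.**  So the crux of record reduces to one explicit
per-point inequality, uniformly in `(q, u)`.

* `levelSetCoQ`, `mem_levelSetCoQ`, `ProfileIneqMinusQ`, `profileIneq_of_minusQ`;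
* `GapMonoQ`, **`profileIneqMinusQ_of_gapMonoQ`**, `profileIneqMinusQ_of_card_le`;
* `GapMonoRuleQ`, `GapMonoAllQ`, `gapMonoRuleQ_of_all`, **`profileIneqMinusQ_of_gapMonoRuleQ`**,
  **`profileIneq_of_gapMonoRuleQ`**, **`c025Profile_of_gapMonoRuleQ`**, **`c025_of_gapMonoRuleQ`**.
-/

open scoped Matroid

namespace PercRepro.Cogirth

open Finset ThmH Skew Shadow Profile

variable {α : Type} [DecidableEq α] {M : Matroid α} [M.Finite]

/-- The rank-`u` sets whose complement has rank at least `q`. -/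
noncomputable def levelSetCoQ (M : Matroid α) [M.Finite] (q u : ℕ) : Finset (Finset α) :=
  (levelSet M u).filter (fun S => q ≤ rk M (gr M \ S))

/-- Membership in `levelSetCoQ`. -/
theorem mem_levelSetCoQ {q u : ℕ} {S : Finset α} :
    S ∈ levelSetCoQ M q u ↔ (S ⊆ gr M ∧ M.eRk (S : Set α) = (u : ℕ∞)) ∧ q ≤ rk M (gr M \ S) := by
  unfold levelSetCoQ
  rw [mem_filter, mem_levelSet]

/-- **The co-rank-`q` row**: `D_q(M; u) ≤ C(u,q) · W⁻_{q,u}(M)`. -/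
def ProfileIneqMinusQ (M : Matroid α) [M.Finite] (q u : ℕ) : Prop :=
  ∑ B ∈ Rq M q, demand M q u B ≤ u.choose q * (levelSetCoQ M q u).card

/-- The co-rank-`q` row implies the row `(Π_{q,u})` (`q ≤ u`). -/
theorem profileIneq_of_minusQ {q u : ℕ} (hqu : q ≤ u) (h : ProfileIneqMinusQ M q u) : ProfileIneq M q u := by
  have hpos : 0 < u.choose q := Nat.choose_pos hqu
  rw [profileIneq_iff_demand q u hqu hpos]
  unfold ProfileIneqMinusQ at h
  exact h.trans (Nat.mul_le_mul_left _ (card_le_card (filter_subset _ _)))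

/-- **Gap-monotonicity at `z` for the row `q`**:
`D_q(M; u) + C(u,q) · W⁻_{q,u}(M ∖ z) ≤ D_q(M ∖ z; u) + C(u,q) · W⁻_{q,u}(M)`. -/
def GapMonoQ (M : Matroid α) [M.Finite] (z : α) (q u : ℕ) : Prop :=
  ∑ B ∈ Rq M q, demand M q u B + u.choose q * (levelSetCoQ (M ＼ ({z} : Set α)) q u).card ≤
    ∑ B ∈ Rq (M ＼ ({z} : Set α)) q, demand (M ＼ ({z} : Set α)) q u B +
      u.choose q * (levelSetCoQ M q u).card

/-- **The induction step at a gap-monotone point.** -/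
theorem profileIneqMinusQ_of_gapMonoQ {z : α} {q u : ℕ} (h : GapMonoQ M z q u)
    (hdel : ProfileIneqMinusQ (M ＼ ({z} : Set α)) q u) : ProfileIneqMinusQ M q u := by
  unfold ProfileIneqMinusQ at hdel ⊢
  unfold GapMonoQ at h
  omega

/-- **The base**: on `≤ u + q` elements the co-rank-`q` row holds — a positive demand forces `#B = q` and
`ρ(E ∖ B) = u = #(E ∖ B)`, and then `B ↦ E ∖ B` lands injectively in `W⁻_{q,u}`. -/
theorem profileIneqMinusQ_of_card_le {q u : ℕ} (hqu : q ≤ u) (hn : (gr M).card ≤ u + q) :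
    ProfileIneqMinusQ M q u := by
  unfold ProfileIneqMinusQ
  have hkey : ∀ B ∈ (Rq M q).filter (fun B => demand M q u B ≠ 0),
      demand M q u B = u.choose q ∧ gr M \ B ∈ levelSetCoQ M q u := by
    intro B hB
    rw [mem_filter, mem_Rq] at hB
    obtain ⟨⟨hBg, hBr⟩, hne⟩ := hB
    have hrq : rk M B = q := by unfold rk; rw [hBr, ENat.toNat_coe]
    have hBc : rk M B ≤ B.card := rk_le_card' B
    have hcomp : (gr M \ B).card = (gr M).card - B.card := card_sdiff_of_subset hBg
    have hrle : rk M (gr M \ B) ≤ (gr M \ B).card := rk_le_card' _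
    have hle : u ≤ rk M (gr M \ B) := by
      by_contra hlt
      apply hne
      unfold demand
      rw [if_neg hlt]
    have hru : rk M (gr M \ B) = u := by omega
    constructor
    · unfold demand
      rw [if_pos hle, hru, Nat.choose_symm hqu]
    · rw [mem_levelSetCoQ, Finset.sdiff_sdiff_eq_self hBg, hrq]
      refine ⟨⟨sdiff_subset, ?_⟩, le_refl _⟩
      rw [← coe_rk, hru]
  calc ∑ B ∈ Rq M q, demand M q u B
      = ∑ B ∈ (Rq M q).filter (fun B => demand M q u B ≠ 0), demand M q u B :=
        (sum_filter_ne_zero _).symm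
    _ = ∑ B ∈ (Rq M q).filter (fun B => demand M q u B ≠ 0), u.choose q :=
        sum_congr rfl (fun B hB => (hkey B hB).1)
    _ = u.choose q * ((Rq M q).filter (fun B => demand M q u B ≠ 0)).card := by
        rw [sum_const, smul_eq_mul, mul_comm]
    _ ≤ u.choose q * (levelSetCoQ M q u).card := by
        apply Nat.mul_le_mul_left
        apply card_le_card_of_injOn (fun B => gr M \ B)
        · intro B hB
          exact (hkey B hB).2
        · intro B hB B' hB' heq
          have hBg : B ⊆ gr M := (mem_Rq.1 (mem_filter.1 hB).1).1
          have hB'g : B' ⊆ gr M := (mem_Rq.1 (mem_filter.1 hB').1).1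
          simp only at heq
          rw [← Finset.sdiff_sdiff_eq_self hBg, ← Finset.sdiff_sdiff_eq_self hB'g, heq]

/-- **The gap-monotonicity rule at `(q, u)`**: every finite matroid on `≥ u + q + 1` elements has a
gap-monotone point.  A CONJECTURE (data only); not asserted here. -/
def GapMonoRuleQ (α : Type) [DecidableEq α] (q u : ℕ) : Prop :=
  ∀ (N : Matroid α) [N.Finite], u + q + 1 ≤ (gr N).card → ∃ z ∈ gr N, GapMonoQ N z q u

/-- **Gap-monotonicity at every point of every finite matroid** at `(q, u)` — the statement the data support. -/
def GapMonoAllQ (α : Type) [DecidableEq α] (q u : ℕ) : Prop :=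
  ∀ (N : Matroid α) [N.Finite], ∀ z ∈ gr N, GapMonoQ N z q u

/-- The all-points statement gives the rule. -/
theorem gapMonoRuleQ_of_all {q u : ℕ} (h : GapMonoAllQ α q u) : GapMonoRuleQ α q u := by
  intro N _ hN
  have hne : (gr N).Nonempty := card_pos.1 (by omega)
  obtain ⟨z, hz⟩ := hne
  exact ⟨z, hz, h N z hz⟩

/-- **The co-rank-`q` row on every finite matroid from the rule** (`q ≤ u`): strong induction on `#E`. -/
theorem profileIneqMinusQ_of_gapMonoRuleQ {q u : ℕ} (hqu : q ≤ u) (h : GapMonoRuleQ α q u)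
    (M : Matroid α) [M.Finite] : ProfileIneqMinusQ M q u := by
  suffices hh : ∀ n : ℕ, ∀ (N : Matroid α) [N.Finite], (gr N).card = n → ProfileIneqMinusQ N q u from
    hh _ M rfl
  intro n
  induction n using Nat.strong_induction_on with
  | _ n ih =>
  intro N _ hN
  rcases Nat.lt_or_ge (gr N).card (u + q + 1) with hsmall | hbig
  · exact profileIneqMinusQ_of_card_le hqu (by omega)
  · obtain ⟨z, hz, hgm⟩ := h N hbig
    have hlt : ((gr N).erase z).card < n := by rw [← hN]; exact card_erase_lt_of_mem hz
    exact profileIneqMinusQ_of_gapMonoQ hgm (ih _ hlt (N ＼ ({z} : Set α)) (by rw [gr_delete']))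

/-- **`(Π_{q,u})` on every finite matroid from the rule** (`q ≤ u`). -/
theorem profileIneq_of_gapMonoRuleQ {q u : ℕ} (hqu : q ≤ u) (h : GapMonoRuleQ α q u)
    (M : Matroid α) [M.Finite] : ProfileIneq M q u :=
  profileIneq_of_minusQ hqu (profileIneqMinusQ_of_gapMonoRuleQ hqu h M)

end PercRepro.Cogirth

namespace PercRepro

/-- **THE PROFILE FAMILY (C-032) FROM THE GAP-MONOTONICITY RULE AT EVERY `(q, u)`.** -/
theorem c025Profile_of_gapMonoRuleQ
    (h : ∀ (α : Type) [DecidableEq α] (q u : ℕ), q < u → Cogirth.GapMonoRuleQ α q u) : C025Profile := by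
  intro α _ M _ q u hqu
  exact Cogirth.profileIneq_of_gapMonoRuleQ hqu.le (h α q u hqu) M

/-- **`C025` ITSELF FROM THE GAP-MONOTONICITY RULE** (through the tree's bridge `c025_of_profile`). -/
theorem c025_of_gapMonoRuleQ
    (h : ∀ (α : Type) [DecidableEq α] (q u : ℕ), q < u → Cogirth.GapMonoRuleQ α q u) : C025 :=
  c025_of_profile (c025Profile_of_gapMonoRuleQ h)

end PercRepro
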